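import Literature.MathematicalPhysics.QuantumFieldTheory.Balaban1983to89.MatrixNorms
import Literature.MathematicalPhysics.QuantumFieldTheory.Balaban1983to89.B10Eq18SigmaSU2
import HarnessLib

/-!
# `SU(2)` letters for LINE 28's linear-proxy identification: a real combination of `U_p − 1`, `U_p ∈ SU(2)`, is read by the three Pauli traces
# (crux `HistoryTailL`, stmt-QuantumFields-19936; construction C3 «tree-gauge dressing», `stub_linTest`)

Cell `ym3-torus` (YM ladder rung R3 = continuum SU(2) Yang–Mills on T³ — a RUNG, NOT the Clay problem: not d = 4, not infinite volume, not a
mass gap); width seat `ym3-torus-px5` g10.  Helper `--supports stmt-QuantumFields-19936`; THEOREMS ONLY (0 `def`, 0 `sorry`, default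
heartbeats); FILE 1 of 2 (the sequel `UnitScaleGibbsLinProxyFluxIdentification` carries the plaquette linearisation, the normal-equation
transfer and the identification).  Pure `2 × 2` matrix algebra over ✓`MatrixNorms` (operator norm ≤ entrywise norm; `U + Uᴴ = Tr U·1` and
`|U − 1|² = 2 − Re Tr U` on `SU(2)`) and ✓`B10Eq18SigmaSU2.pauli` (print's «three Pauli matrices», [Balaban1985UV3] p. 260), used BY NAME.

* `abs_re_trace_le_two_mul_norm` (`|Re Tr X| ≤ 2‖X‖`), `trace_mul_fin_two`, `I_smul_pauli_zero∕one∕two` (`τ_α := iσ_α` in entries),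
  `conjTranspose_I_smul_pauli` (skew-Hermitian), `trace_I_smul_pauli` (traceless), `norm_I_smul_pauli_le_two`, `re_trace_I_smul_pauli_mul`
  (the three Pauli traces in entries).
* ★★`norm_sq_le_half_sum_sq_of_skewHermitian_traceless`: for skew-Hermitian traceless `S`, `‖S‖² ≤ Σ|S_ij|² = ½Σ_α(Re Tr(τ_αS))²`;
  `norm_le_sum_abs_of_skewHermitian_traceless` (crude form `‖S‖ ≤ Σ_α|Re Tr(τ_αS)|`).
* ★`sub_one_add_conjTranspose` (`(U−1) + (U−1)ᴴ = (Re Tr U − 2)·1`, `U ∈ SU(2)`: the quaternion fact), ★`re_trace_sub_two_eq`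
  (`Re Tr U − 2 = −‖U − 1‖²` EXACTLY), `re_trace_mul_sum_smul` (linearity),
  ★★★`norm_sum_smul_sub_one_le : ‖Σ_p c_p(U_p − 1)‖ ≤ Σ_α|Re Tr(τ_α·Σ_p c_p(U_p − 1))| + ½Σ_p|c_p|·‖U_p − 1‖²` — a real combination of
  `SU(2) − 1` lies in `ℝ·1 ⊕ 𝔰𝔲(2)`; the `𝔰𝔲(2)` part is read exactly by the Pauli traces (blind to `ℝ·1`), the `ℝ·1` part is second order.

HONEST SCOPE.  Finite-dimensional algebra; nothing of `stub_linTest`, the other stubs of LINE 28, «ShallowFluxSecondMomentL», (Q),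
23083∕23133∕23134, K1, `MeanDeviationL`, `HistoryTailL`, the rung R3, d = 4, a continuum limit or a mass gap is proved here; the
Yang–Mills mass gap is NOT proved.

References: T. Bałaban, CMP 102 (1985) 255–275, p. 260 (Pauli matrices as generators) [Balaban1985UV3]; CMP 109 (1987) 249–301, (0.14)
p.254 [Balaban1987RG1].
-/

set_option autoImplicit false

noncomputable section

open scoped BigOperators Matrix Matrix.Norms.L2Operator ComplexConjugate
open Complex Finset
open Literature.MathematicalPhysics.QuantumFieldTheory.Balaban1983to89
open Literature.MathematicalPhysics.QuantumFieldTheory.Balaban1983to89.MatrixNorms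
  (opNorm_sq_le_sum_norm_sq add_conjTranspose_of_mem_specialUnitaryGroup_two opDist1_sq_eq_of_mem_specialUnitaryGroup_two
    norm_ntr_le_opNorm ntr)
open Literature.MathematicalPhysics.QuantumFieldTheory.Balaban1983to89.UnitaryModel (nReTr opDist1)
open Literature.MathematicalPhysics.QuantumFieldTheory.Balaban1983to89.B10Eq18SigmaSU2 (pauli)

namespace Summit.QuantumFields.YangMills.Theorems.UnitScaleGibbsLinProxySU2Letters

/-! ## §1  `SU(2)` algebra: a real combination of `U − 1`, `U ∈ SU(2)`, lies in `ℝ·1 ⊕ 𝔰𝔲(2)`; the `𝔰𝔲(2)` part is read by the Pauli traces -/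

section SU2

/-- The trace of a `2 × 2` matrix is bounded by twice its operator norm. [folklore] -/
theorem abs_re_trace_le_two_mul_norm (X : Matrix (Fin 2) (Fin 2) ℂ) : |X.trace.re| ≤ 2 * ‖X‖ := by
  have h := norm_ntr_le_opNorm X
  have hntr : ntr X = X.trace / 2 := by simp [ntr]
  rw [hntr, norm_div, RCLike.norm_ofNat, div_le_iff₀ (by norm_num : (0:ℝ) < 2)] at h
  calc |X.trace.re| ≤ ‖X.trace‖ := Complex.abs_re_le_norm _
    _ ≤ 2 * ‖X‖ := by linarith

/-- The trace of a product of `2 × 2` matrices, in entries. [folklore] -/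
theorem trace_mul_fin_two (A X : Matrix (Fin 2) (Fin 2) ℂ) :
    (A * X).trace = A 0 0 * X 0 0 + A 0 1 * X 1 0 + A 1 0 * X 0 1 + A 1 1 * X 1 1 := by
  simp [Matrix.trace_fin_two, Matrix.mul_apply, Fin.sum_univ_two]
  ring

/-- `τ₀ = iσ₁`, in entries. [folklore] -/
theorem I_smul_pauli_zero : I • pauli 0 = !![0, I; I, 0] := by
  ext i j; fin_cases i <;> fin_cases j <;> simp [pauli]

/-- `τ₁ = iσ₂`, in entries. [folklore] -/
theorem I_smul_pauli_one : I • pauli 1 = !![0, 1; -1, 0] := by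
  ext i j; fin_cases i <;> fin_cases j <;> simp [pauli]

/-- `τ₂ = iσ₃`, in entries. [folklore] -/
theorem I_smul_pauli_two : I • pauli 2 = !![I, 0; 0, -I] := by
  ext i j; fin_cases i <;> fin_cases j <;> simp [pauli]

/-- `τ_α := I • σ_α` is skew-Hermitian. [folklore] -/
theorem conjTranspose_I_smul_pauli (α : Fin 3) : (I • pauli α)ᴴ = -(I • pauli α) := by
  fin_cases α
  · show (I • pauli 0)ᴴ = -(I • pauli 0)
    rw [I_smul_pauli_zero]
    ext i j; fin_cases i <;> fin_cases j <;> simp [Matrix.conjTranspose_apply]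
  · show (I • pauli 1)ᴴ = -(I • pauli 1)
    rw [I_smul_pauli_one]
    ext i j; fin_cases i <;> fin_cases j <;> simp [Matrix.conjTranspose_apply]
  · show (I • pauli 2)ᴴ = -(I • pauli 2)
    rw [I_smul_pauli_two]
    ext i j; fin_cases i <;> fin_cases j <;> simp [Matrix.conjTranspose_apply]

/-- `τ_α` is traceless. [folklore] -/
theorem trace_I_smul_pauli (α : Fin 3) : (I • pauli α).trace = 0 := by
  fin_cases α
  · show (I • pauli 0).trace = 0
    rw [I_smul_pauli_zero]; simp [Matrix.trace_fin_two]
  · show (I • pauli 1).trace = 0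
    rw [I_smul_pauli_one]; simp [Matrix.trace_fin_two]
  · show (I • pauli 2).trace = 0
    rw [I_smul_pauli_two]; simp [Matrix.trace_fin_two]

/-- The operator norm of `τ_α` is at most `√2 ≤ 2` (entrywise bound; the sharp value `1` is not needed). [folklore] -/
theorem norm_I_smul_pauli_le_two (α : Fin 3) : ‖I • pauli α‖ ≤ 2 := by
  have h := opNorm_sq_le_sum_norm_sq (I • pauli α)
  have h2 : ∑ i, ∑ j, ‖(I • pauli α) i j‖ ^ 2 = 2 := by
    fin_cases α
    · show ∑ i, ∑ j, ‖(I • pauli 0) i j‖ ^ 2 = 2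
      rw [I_smul_pauli_zero]; simp [Fin.sum_univ_two]; norm_num
    · show ∑ i, ∑ j, ‖(I • pauli 1) i j‖ ^ 2 = 2
      rw [I_smul_pauli_one]; simp [Fin.sum_univ_two]; norm_num
    · show ∑ i, ∑ j, ‖(I • pauli 2) i j‖ ^ 2 = 2
      rw [I_smul_pauli_two]; simp [Fin.sum_univ_two]; norm_num
  rw [h2] at h
  nlinarith [norm_nonneg (I • pauli α)]

/-- The three Pauli traces of a `2 × 2` matrix, in entries. [folklore] -/
theorem re_trace_I_smul_pauli_mul (X : Matrix (Fin 2) (Fin 2) ℂ) :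
    ((I • pauli 0) * X).trace.re = -(X 1 0).im - (X 0 1).im ∧
    ((I • pauli 1) * X).trace.re = (X 1 0).re - (X 0 1).re ∧
    ((I • pauli 2) * X).trace.re = -(X 0 0).im + (X 1 1).im := by
  refine ⟨?_, ?_, ?_⟩
  · rw [trace_mul_fin_two, I_smul_pauli_zero]; simp; ring
  · rw [trace_mul_fin_two, I_smul_pauli_one]; simp; ring
  · rw [trace_mul_fin_two, I_smul_pauli_two]; simp

/-- ★★ **The `𝔰𝔲(2)` coordinates control the norm**: for a skew-Hermitian traceless `2 × 2` matrix `S`,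
`‖S‖² ≤ Σ_{ij} |S_{ij}|² = ½ Σ_α (Re Tr(τ_α S))²`. [folklore] -/
theorem norm_sq_le_half_sum_sq_of_skewHermitian_traceless (S : Matrix (Fin 2) (Fin 2) ℂ)
    (hS : Sᴴ = -S) (htr : S.trace = 0) :
    ‖S‖ ^ 2 ≤ (1 / 2) * ∑ α : Fin 3, (((I • pauli α) * S).trace.re) ^ 2 := by
  -- entries: `S 0 0 = i z`, `S 1 1 = −i z`, `S 1 0 = −conj (S 0 1)`
  have e00 := congr_fun (congr_fun hS 0) 0
  have e11 := congr_fun (congr_fun hS 1) 1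
  have e10 := congr_fun (congr_fun hS 1) 0
  simp only [Matrix.conjTranspose_apply, Matrix.neg_apply, Complex.star_def] at e00 e11 e10
  have h00 : (S 0 0).re = 0 := by
    have := congrArg Complex.re e00; simp at this; linarith
  have h11re : (S 1 1).re = 0 := by
    have := congrArg Complex.re e11; simp at this; linarith
  have h11im : (S 1 1).im = -(S 0 0).im := by
    have h := congrArg Complex.im htr
    simp [Matrix.trace_fin_two] at h; linarith
  have h10re : (S 1 0).re = -(S 0 1).re := by
    have := congrArg Complex.re e10; simp at this; linarith
  have h10im : (S 1 0).im = (S 0 1).im := by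
    have := congrArg Complex.im e10; simp at this; linarith
  obtain ⟨t0, t1, t2⟩ := re_trace_I_smul_pauli_mul S
  have hF := opNorm_sq_le_sum_norm_sq S
  have hsum : ∑ i, ∑ j, ‖S i j‖ ^ 2 = ‖S 0 0‖ ^ 2 + ‖S 0 1‖ ^ 2 + (‖S 1 0‖ ^ 2 + ‖S 1 1‖ ^ 2) := by
    simp [Fin.sum_univ_two]
  have hn : ∀ z : ℂ, ‖z‖ ^ 2 = z.re ^ 2 + z.im ^ 2 := fun z => by
    rw [Complex.sq_norm, Complex.normSq_apply]; ring
  rw [hsum, hn, hn, hn, hn, h00, h11re, h11im, h10re, h10im] at hF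
  rw [Fin.sum_univ_three, t0, t1, t2, h11im, h10re, h10im]
  nlinarith [hF]

/-- For skew-Hermitian traceless `2 × 2` `S`: `‖S‖ ≤ Σ_α |Re Tr(τ_α S)|` (crude form of the coordinate bound).
[folklore] -/
theorem norm_le_sum_abs_of_skewHermitian_traceless (S : Matrix (Fin 2) (Fin 2) ℂ)
    (hS : Sᴴ = -S) (htr : S.trace = 0) :
    ‖S‖ ≤ ∑ α : Fin 3, |((I • pauli α) * S).trace.re| := by
  have h := norm_sq_le_half_sum_sq_of_skewHermitian_traceless S hS htr
  have hsum0 : 0 ≤ ∑ α : Fin 3, |((I • pauli α) * S).trace.re| := sum_nonneg fun _ _ => abs_nonneg _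
  rw [Fin.sum_univ_three] at h hsum0 ⊢
  have h0 := abs_nonneg ((I • pauli 0) * S).trace.re
  have h1 := abs_nonneg ((I • pauli 1) * S).trace.re
  have h2 := abs_nonneg ((I • pauli 2) * S).trace.re
  have s0 := sq_abs ((I • pauli 0) * S).trace.re
  have s1 := sq_abs ((I • pauli 1) * S).trace.re
  have s2 := sq_abs ((I • pauli 2) * S).trace.re
  nlinarith [norm_nonneg S]

/-- **The quaternion fact**: for `U ∈ SU(2)`, `(U − 1) + (U − 1)ᴴ = (Re Tr U − 2)·1` (Cayley–Hamilton with `det U = 1`,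
✓`MatrixNorms.add_conjTranspose_of_mem_specialUnitaryGroup_two`) — so `U − 1 ∈ ℝ·1 ⊕ 𝔰𝔲(2)`. [folklore] -/
theorem sub_one_add_conjTranspose (U : Matrix.specialUnitaryGroup (Fin 2) ℂ) :
    ((U : Matrix (Fin 2) (Fin 2) ℂ) - 1) + ((U : Matrix (Fin 2) (Fin 2) ℂ) - 1)ᴴ =
      ((((U : Matrix (Fin 2) (Fin 2) ℂ).trace.re - 2 : ℝ) : ℂ)) • (1 : Matrix (Fin 2) (Fin 2) ℂ) := by
  have hsum := add_conjTranspose_of_mem_specialUnitaryGroup_two U.2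
  have htr_im : (U : Matrix (Fin 2) (Fin 2) ℂ).trace.im = 0 := by
    have h := congrArg (fun M : Matrix (Fin 2) (Fin 2) ℂ => (Matrix.trace M).im) hsum
    simp only [Matrix.trace_add, Matrix.trace_conjTranspose, Matrix.trace_smul, Matrix.trace_one,
      Fintype.card_fin, Nat.cast_ofNat, smul_eq_mul, Complex.add_im, Complex.star_def, Complex.conj_im,
      Complex.mul_im, Complex.re_ofNat, Complex.im_ofNat] at h
    linarith
  set t : ℝ := (U : Matrix (Fin 2) (Fin 2) ℂ).trace.re with ht
  have htr : (U : Matrix (Fin 2) (Fin 2) ℂ).trace = (t : ℂ) := by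
    apply Complex.ext <;> simp [ht, htr_im]
  rw [Matrix.conjTranspose_sub, Matrix.conjTranspose_one]
  calc (U : Matrix (Fin 2) (Fin 2) ℂ) - 1 + ((U : Matrix (Fin 2) (Fin 2) ℂ)ᴴ - 1)
      = ((U : Matrix (Fin 2) (Fin 2) ℂ) + (U : Matrix (Fin 2) (Fin 2) ℂ)ᴴ) - (2 : ℂ) • (1 : Matrix (Fin 2) (Fin 2) ℂ) := by
        rw [two_smul]; abel
    _ = _ := by
        rw [hsum, htr, ← sub_smul]
        congr 1
        push_cast; ring

/-- **The scalar part is second order**: for `U ∈ SU(2)`, `Re Tr U − 2 = −‖U − 1‖²` EXACTLY (operator norm;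
✓`MatrixNorms.opDist1_sq_eq_of_mem_specialUnitaryGroup_two`). [cite: Balaban1987RG1, (0.14) p.254] -/
theorem re_trace_sub_two_eq (U : Matrix.specialUnitaryGroup (Fin 2) ℂ) :
    (U : Matrix (Fin 2) (Fin 2) ℂ).trace.re - 2 = -‖(U : Matrix (Fin 2) (Fin 2) ℂ) - 1‖ ^ 2 := by
  have h := opDist1_sq_eq_of_mem_specialUnitaryGroup_two U.2
  simp only [opDist1, nReTr, Fintype.card_fin, Nat.cast_ofNat] at h
  linarith

/-- Linearity of the Pauli traces over a real combination. [folklore] -/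
theorem re_trace_mul_sum_smul {ι : Type*} (s : Finset ι) (T : Matrix (Fin 2) (Fin 2) ℂ) (c : ι → ℝ)
    (X : ι → Matrix (Fin 2) (Fin 2) ℂ) :
    (T * ∑ p ∈ s, (c p : ℂ) • X p).trace.re = ∑ p ∈ s, c p * (T * X p).trace.re := by
  rw [Finset.mul_sum, Matrix.trace_sum, Complex.re_sum]
  refine Finset.sum_congr rfl fun p _ => ?_
  rw [Matrix.mul_smul, Matrix.trace_smul, smul_eq_mul, Complex.re_ofReal_mul]

/-- ★★★ **A REAL COMBINATION OF `U_p − 1`, `U_p ∈ SU(2)`, IS READ BY THE THREE PAULI TRACES UP TO SECOND ORDER**: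
`‖Σ_p c_p (U_p − 1)‖ ≤ Σ_α |Re Tr(τ_α · Σ_p c_p (U_p − 1))| + ½ Σ_p |c_p|·‖U_p − 1‖²` (operator norm, `τ_α = iσ_α`).
The combination lies in `ℝ·1 ⊕ 𝔰𝔲(2)`; its `𝔰𝔲(2)` part is controlled by the Pauli traces (which do not see `ℝ·1`), its
`ℝ·1` part is `½ Σ_p c_p (Re Tr U_p − 2) = −½ Σ_p c_p ‖U_p − 1‖²`. [folklore] -/
theorem norm_sum_smul_sub_one_le {ι : Type*} (s : Finset ι) (c : ι → ℝ)
    (U : ι → Matrix.specialUnitaryGroup (Fin 2) ℂ) :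
    ‖∑ p ∈ s, (c p : ℂ) • ((U p : Matrix (Fin 2) (Fin 2) ℂ) - 1)‖ ≤
      ∑ α : Fin 3, |((I • pauli α) * ∑ p ∈ s, (c p : ℂ) • ((U p : Matrix (Fin 2) (Fin 2) ℂ) - 1)).trace.re|
        + (1 / 2) * ∑ p ∈ s, |c p| * ‖(U p : Matrix (Fin 2) (Fin 2) ℂ) - 1‖ ^ 2 := by
  set M : Matrix (Fin 2) (Fin 2) ℂ := ∑ p ∈ s, (c p : ℂ) • ((U p : Matrix (Fin 2) (Fin 2) ℂ) - 1) with hM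
  -- the scalar part
  set R : ℝ := (1 / 2) * ∑ p ∈ s, c p * (((U p : Matrix (Fin 2) (Fin 2) ℂ)).trace.re - 2) with hR
  -- `M + Mᴴ = 2R • 1`
  have hMM : M + Mᴴ = ((2 * R : ℝ) : ℂ) • (1 : Matrix (Fin 2) (Fin 2) ℂ) := by
    have : M + Mᴴ = (∑ p ∈ s, (((c p * (((U p : Matrix (Fin 2) (Fin 2) ℂ)).trace.re - 2) : ℝ) : ℂ))) •
        (1 : Matrix (Fin 2) (Fin 2) ℂ) := by
      rw [Finset.sum_smul, hM, Matrix.conjTranspose_sum, ← Finset.sum_add_distrib]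
      refine Finset.sum_congr rfl fun p _ => ?_
      rw [Matrix.conjTranspose_smul, Complex.star_def, Complex.conj_ofReal, ← smul_add, sub_one_add_conjTranspose,
        smul_smul]
      push_cast; rfl
    rw [this]
    congr 1
    rw [hR]; push_cast
    simp only [Finset.mul_sum]
    exact Finset.sum_congr rfl fun p _ => by ring
  -- the traceless skew-Hermitian part `S := M − R • 1`
  set S : Matrix (Fin 2) (Fin 2) ℂ := M - ((R : ℝ) : ℂ) • (1 : Matrix (Fin 2) (Fin 2) ℂ) with hS
  have hSskew : Sᴴ = -S := by
    rw [hS, Matrix.conjTranspose_sub, Matrix.conjTranspose_smul, Matrix.conjTranspose_one, Complex.star_def,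
      Complex.conj_ofReal]
    have h2 : Mᴴ = ((2 * R : ℝ) : ℂ) • (1 : Matrix (Fin 2) (Fin 2) ℂ) - M := eq_sub_of_add_eq' hMM
    rw [h2]
    have : ((2 * R : ℝ) : ℂ) • (1 : Matrix (Fin 2) (Fin 2) ℂ) = ((R : ℝ) : ℂ) • 1 + ((R : ℝ) : ℂ) • 1 := by
      rw [← add_smul]; congr 1; push_cast; ring
    rw [this]; abel
  have hStr : S.trace = 0 := by
    have htrM : M.trace = ((2 * R : ℝ) : ℂ) := by
      rw [hM, Matrix.trace_sum]
      have : ∀ p ∈ s, ((c p : ℂ) • ((U p : Matrix (Fin 2) (Fin 2) ℂ) - 1)).trace =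
          ((c p * (((U p : Matrix (Fin 2) (Fin 2) ℂ)).trace.re - 2) : ℝ) : ℂ) := by
        intro p _
        -- `Tr(U_p − 1) = Tr U_p − 2`, and `Tr U_p` is real: read it off `(U−1)+(U−1)ᴴ = (Re Tr U − 2)•1`
        have h1 := congrArg Matrix.trace (sub_one_add_conjTranspose (U p))
        rw [Matrix.trace_add, Matrix.trace_conjTranspose, Matrix.trace_smul, Matrix.trace_one, Fintype.card_fin] at h1
        -- `Tr(U−1) + conj Tr(U−1) = (Re Tr U − 2)·2` ⇒ `Re Tr(U−1) = Re Tr U − 2`, `Im` free; but `Im Tr(U − 1) = 0` too: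
        have hre : ((U p : Matrix (Fin 2) (Fin 2) ℂ) - 1).trace.re = ((U p : Matrix (Fin 2) (Fin 2) ℂ)).trace.re - 2 := by
          rw [Matrix.trace_sub, Matrix.trace_one, Fintype.card_fin]; simp
        have him : ((U p : Matrix (Fin 2) (Fin 2) ℂ) - 1).trace.im = 0 := by
          have hsum := add_conjTranspose_of_mem_specialUnitaryGroup_two (U p).2
          have h := congrArg (fun M : Matrix (Fin 2) (Fin 2) ℂ => (Matrix.trace M).im) hsum
          simp only [Matrix.trace_add, Matrix.trace_conjTranspose, Matrix.trace_smul, Matrix.trace_one,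
            Fintype.card_fin, Nat.cast_ofNat, smul_eq_mul, Complex.add_im, Complex.star_def, Complex.conj_im,
            Complex.mul_im, Complex.re_ofNat, Complex.im_ofNat] at h
          rw [Matrix.trace_sub, Matrix.trace_one, Fintype.card_fin]; simp; linarith
        rw [Matrix.trace_smul, smul_eq_mul]
        have hz : ((U p : Matrix (Fin 2) (Fin 2) ℂ) - 1).trace =
            ((((U p : Matrix (Fin 2) (Fin 2) ℂ)).trace.re - 2 : ℝ) : ℂ) := by
          apply Complex.ext
          · rw [hre]; simp
          · rw [him]; simp
        rw [hz]; push_cast; ring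
      rw [Finset.sum_congr rfl this, hR]
      push_cast
      simp only [Finset.mul_sum]
      exact Finset.sum_congr rfl fun p _ => by ring
    rw [hS, Matrix.trace_sub, Matrix.trace_smul, Matrix.trace_one, Fintype.card_fin, htrM, smul_eq_mul]
    push_cast; ring
  -- `M = S + R • 1`
  have hMdec : M = S + ((R : ℝ) : ℂ) • (1 : Matrix (Fin 2) (Fin 2) ℂ) := by rw [hS]; abel
  -- the Pauli traces of `S` are those of `M`
  have htrS : ∀ α : Fin 3, ((I • pauli α) * S).trace.re = ((I • pauli α) * M).trace.re := by
    intro α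
    rw [hS, mul_sub, Matrix.trace_sub, Matrix.mul_smul, mul_one, Matrix.trace_smul, trace_I_smul_pauli,
      smul_zero, sub_zero]
  -- the scalar part is second order
  have hRle : |R| ≤ (1 / 2) * ∑ p ∈ s, |c p| * ‖(U p : Matrix (Fin 2) (Fin 2) ℂ) - 1‖ ^ 2 := by
    rw [hR, abs_mul, abs_of_pos (by norm_num : (0:ℝ) < 1 / 2)]
    refine mul_le_mul_of_nonneg_left ((Finset.abs_sum_le_sum_abs _ _).trans (Finset.sum_le_sum fun p _ => ?_))
      (by norm_num)
    rw [re_trace_sub_two_eq, abs_mul, abs_neg, abs_of_nonneg (sq_nonneg ‖(U p : Matrix (Fin 2) (Fin 2) ℂ) - 1‖)]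
  -- assemble
  calc ‖M‖ = ‖S + ((R : ℝ) : ℂ) • (1 : Matrix (Fin 2) (Fin 2) ℂ)‖ := by rw [← hMdec]
    _ ≤ ‖S‖ + ‖((R : ℝ) : ℂ) • (1 : Matrix (Fin 2) (Fin 2) ℂ)‖ := norm_add_le _ _
    _ = ‖S‖ + |R| := by rw [norm_smul, norm_one, mul_one, Complex.norm_real, Real.norm_eq_abs]
    _ ≤ (∑ α : Fin 3, |((I • pauli α) * S).trace.re|) + |R| := by
        gcongr; exact norm_le_sum_abs_of_skewHermitian_traceless S hSskew hStr
    _ = (∑ α : Fin 3, |((I • pauli α) * M).trace.re|) + |R| := by simp only [htrS]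
    _ ≤ _ := by gcongr

end SU2

end Summit.QuantumFields.YangMills.Theorems.UnitScaleGibbsLinProxySU2Letters

end
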